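import Literature.NumberTheory.Automorphic.UnitaryGroupOrbitalMeasureOfLocalQuotient      -- ★ `isHaarMeasure_map_subgroupCongrHomeomorph`, `isInvInvariant_map_subgroupCongrHomeomorph`; brings `subgroupCongrHomeomorph`
import Literature.NumberTheory.Automorphic.UnitaryGroupOrbitalMeasureFamilyOfLocal        -- ★ `continuous_mulAutConj`, `continuous_mulAutConj_symm`
import Literature.MeasureTheory.Group.InvariantQuotientOrbitalTransport                   -- ★ `forall_apply_mem_centralizer_singleton_iff_of_eq`
import HarnessLib

/-!
# Conjugation-coherence of centraliser Haar measures: inner automorphisms of the centraliser fix a two-sided Haar measure, and PROBABILITY Haar measures are carried to each other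
(Deitmar–Echterhoff (2014) Thm. 1.5.3, Prop. 1.5.5; Folland (1995) §2.2 Thm. 2.20; Rogawski (1990) §1.7 p. 6 «all measures on groups are assumed to be Haar measures»)

Topic `NumberTheory/Automorphic` (generic locally compact groups); namespace `Literature.NumberTheory.Automorphic`.  THEOREMS ONLY (no definition, no instance, no notation, no named fact, no
`sorry`).  Cell `pub/hodgecm-mathlib`, crux H413 (`stmt-HodgeConjecture-24833`); (ST-∞) witness road (W1-coh) of census `CENSUS-E4b-SingularPinsBuilt` 1291225b (F0P3-p03 (g10)): the two
CONJUGATOR-FREE cases of the coherence `(ρZ σ₁).map (conj g|_Z) = ρZ σ₂` of a pinned centraliser family — (i) `g` in the centraliser itself (every inner automorphism of a unimodular `Z`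
fixes its Haar measure: reduces coherence for ALL conjugators to coherence for ONE), (ii) both measures PROBABILITY Haar (the compact-wall pin): any conjugator carries one to the other.
Author F0P3-p03 (g10), 2026-09-01.  HONEST LABEL: HC_CM is proved only modulo the printed citations until rung 0 closes; elementary measure plumbing.

* `map_subgroupCongrHomeomorph_conj_eq_self_of_mem` — for `ζ ∈ H` and a left- AND right-invariant measure `μ` on `H`: `(conj ζ|_H)_* μ = μ`.
* `isMulRightInvariant_of_isInvInvariant` — a left-invariant inversion-invariant measure is right-invariant (so Haar + inversion-invariant centraliser measures qualify).
* `map_subgroupCongrHomeomorph_conj_eq_of_measure_univ_eq_one` — Haar measures of total mass `1` on `Z(γ₁)`, `Z(γ₂)` with `g γ₁ g⁻¹ = γ₂`: `(conj g|_Z)_* ρ₁ = ρ₂` (Haar uniqueness on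
  the second countable locally compact `Z(γ₂)`, masses match).

## References
* [DeitmarEchterhoff2014] A. Deitmar, S. Echterhoff, *Principles of Harmonic Analysis*, 2nd ed. (2014), Thm. 1.5.3, Prop. 1.5.5 (unimodular groups).
* [Folland1995] G. B. Folland, *A Course in Abstract Harmonic Analysis* (1995), §2.2 Thm. 2.20 (uniqueness of Haar measure).
* [Rogawski1990] J. D. Rogawski, *Automorphic Representations of Unitary Groups in Three Variables*, Ann. of Math. Stud. 123 (1990), §1.7 p. 6.
-/

set_option autoImplicit false

noncomputable section

open MeasureTheory Measure Set Topology
open Literature.MeasureTheory.Group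
open scoped ENNReal NNReal

namespace Literature.NumberTheory.Automorphic

section Generic

variable {G : Type*} [Group G] [TopologicalSpace G] [IsTopologicalGroup G] [MeasurableSpace G] [BorelSpace G]

/-- **A left-invariant, inversion-invariant measure is right-invariant** (`μ = μ.inv` and `μ.inv` is right-invariant).  So the «Haar ∧ inversion-invariant» centraliser measures of the
(R1-h)∕(R1-i) chain are two-sided. [cite: DeitmarEchterhoff2014, Prop. 1.5.5] -/
theorem isMulRightInvariant_of_isInvInvariant (μ : Measure G) [μ.IsMulLeftInvariant] [μ.IsInvInvariant] : μ.IsMulRightInvariant := by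
  rw [← μ.inv_eq_self]
  infer_instance

/-- **INNER AUTOMORPHISMS OF `H` FIX A TWO-SIDED HAAR MEASURE OF `H`**: for `ζ ∈ H` and `μ` left- and right-invariant on `H`, transporting `μ` along the restriction `conj ζ|_H : H ≃ₜ H`
gives back `μ` (`conj ζ = (ζ · ) ∘ ( · ζ⁻¹)` on `H`). [cite: DeitmarEchterhoff2014, Prop. 1.5.5] [cite: Folland1995, §2.2 Thm. 2.20] -/
theorem map_subgroupCongrHomeomorph_conj_eq_self_of_mem (H : Subgroup G) (ζ : G) (hζ : ζ ∈ H)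
    (hHH : ∀ g, (MulAut.conj ζ : G ≃* G) g ∈ H ↔ g ∈ H) (μ : Measure H) [μ.IsMulLeftInvariant] [μ.IsMulRightInvariant] :
    μ.map (subgroupCongrHomeomorph (MulAut.conj ζ : G ≃* G) H H hHH (continuous_mulAutConj ζ) (continuous_mulAutConj_symm ζ)) = μ := by
  have hfun : (⇑(subgroupCongrHomeomorph (MulAut.conj ζ : G ≃* G) H H hHH (continuous_mulAutConj ζ) (continuous_mulAutConj_symm ζ)) : H → H) =
      (fun h : H => h * (⟨ζ, hζ⟩ : H)⁻¹) ∘ (fun h : H => (⟨ζ, hζ⟩ : H) * h) := by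
    funext h
    apply Subtype.ext
    rw [coe_subgroupCongrHomeomorph_apply]
    simp only [Function.comp_apply, Subgroup.coe_mul, Subgroup.coe_inv, MulAut.conj_apply]
  rw [hfun, ← Measure.map_map (measurable_mul_const _) (measurable_const_mul _), map_mul_left_eq_self, map_mul_right_eq_self]

variable [LocallyCompactSpace G] [SecondCountableTopology G]

/-- **PROBABILITY HAAR MEASURES ON CONJUGATE CENTRALISERS CORRESPOND**: if `g γ₁ g⁻¹ = γ₂` and `ρ₁`, `ρ₂` are Haar measures of total mass `1` on `Z(γ₁)`, `Z(γ₂)`, then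
`(conj g|_Z)_* ρ₁ = ρ₂` — the transported measure is a Haar measure of mass `1` on `Z(γ₂)`, and Haar measure on the second countable locally compact group `Z(γ₂)` is unique up to a
scalar, read off on `univ`.  (The compact-wall pin of the (ST-∞) witness: `U(2) × U(1)`-type centralisers with the probability Haar measure.)
[cite: Folland1995, §2.2 Thm. 2.20] [cite: Rogawski1990, §1.7 p. 6] -/
theorem map_subgroupCongrHomeomorph_conj_eq_of_measure_univ_eq_one (γ₁ γ₂ g : G) (hg : (MulAut.conj g : G ≃* G) γ₁ = γ₂)
    (hZ₁ : IsClosed ((Subgroup.centralizer ({γ₁} : Set G) : Subgroup G) : Set G)) (hZ₂ : IsClosed ((Subgroup.centralizer ({γ₂} : Set G) : Subgroup G) : Set G))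
    (ρ₁ : Measure (Subgroup.centralizer ({γ₁} : Set G))) [ρ₁.IsHaarMeasure] (h₁ : ρ₁ Set.univ = 1)
    (ρ₂ : Measure (Subgroup.centralizer ({γ₂} : Set G))) [ρ₂.IsHaarMeasure] (h₂ : ρ₂ Set.univ = 1) :
    ρ₁.map (subgroupCongrHomeomorph (MulAut.conj g : G ≃* G) (Subgroup.centralizer ({γ₁} : Set G)) (Subgroup.centralizer ({γ₂} : Set G))
      (forall_apply_mem_centralizer_singleton_iff_of_eq (MulAut.conj g : G ≃* G) hg) (continuous_mulAutConj g) (continuous_mulAutConj_symm g)) = ρ₂ := by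
  haveI : LocallyCompactSpace (Subgroup.centralizer ({γ₁} : Set G)) := hZ₁.isClosedEmbedding_subtypeVal.locallyCompactSpace
  haveI : LocallyCompactSpace (Subgroup.centralizer ({γ₂} : Set G)) := hZ₂.isClosedEmbedding_subtypeVal.locallyCompactSpace
  haveI : SecondCountableTopology (Subgroup.centralizer ({γ₂} : Set G)) := TopologicalSpace.Subtype.secondCountableTopology _
  set φ := subgroupCongrHomeomorph (MulAut.conj g : G ≃* G) (Subgroup.centralizer ({γ₁} : Set G)) (Subgroup.centralizer ({γ₂} : Set G))
      (forall_apply_mem_centralizer_singleton_iff_of_eq (MulAut.conj g : G ≃* G) hg) (continuous_mulAutConj g) (continuous_mulAutConj_symm g) with hφ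
  haveI : (ρ₁.map φ).IsHaarMeasure := isHaarMeasure_map_subgroupCongrHomeomorph _ _ _ _ _ _ _
  -- Haar uniqueness on `Z(γ₂)`: the transport is `k • ρ₂`; masses give `k = 1`
  have hk := isMulLeftInvariant_eq_smul (ρ₁.map φ) ρ₂
  have hmass : (ρ₁.map φ) Set.univ = 1 := by
    rw [← φ.toMeasurableEquiv_coe, MeasurableEquiv.map_apply, Set.preimage_univ, h₁]
  have hk1 : (ρ₁.map φ).haarScalarFactor ρ₂ = 1 := by
    have h := congrArg (fun μ : Measure (Subgroup.centralizer ({γ₂} : Set G)) => μ Set.univ) hk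
    simp only [hmass, Measure.smul_apply, h₂, ENNReal.smul_def, smul_eq_mul, mul_one] at h
    exact_mod_cast h.symm
  rw [hk, hk1, one_smul]

end Generic

end Literature.NumberTheory.Automorphic

end
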